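import Summits.Ventures.PercRepro.Night2NoLoadsFair
import Summits.Ventures.PercRepro.Night2HitLoadLines

/-!
# night-2: THE HIGH-LEVEL THEOREM FROM ANY START LEVEL — the lines through the basis (gen 39)

`highIncomeFrom N s := Σ_{i ≥ s} [N ≤ i + 3 ? C(N, i) · 3/C(i+5, 4) : (11/18) (C(N, i) − 5 C(N−2, i))⁺ · 3/C(i+5, 4)]`
(`highIncomeTop N L = highIncomeFrom N (L + 3)`, `freeIncome N = highIncomeFrom N 1`).  With the three-line unloaded lemma
(`dload_eq_zero_of_level_of_three_lines_le`: `L₂ / L₁ / L₀` = the longest line through two / one / no basis point) the levels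
`≥ s := max (L₂ + 3) (L₁ + 2) (L₀ + 1)` are unloaded, so **`basis_pair_fair_of_high_levels_from`**: `1 ≤ highIncomeFrom N s` ⇒ fair.
When the long lines of `W` avoid the basis this certifies two levels more than `basis_pair_fair_of_high_levels_top`
(the census of kit j335557: `(8, 3)` with `L₂ = 2`: `1.107` against `0.307`).  Paper: proofs/NIGHT-2-g39.md §7 (3).
-/

namespace PercRepro.Shadow

open PercRepro.ThmH PercRepro.PerFlat

variable {α : Type*} [DecidableEq α] {M : Matroid α} [M.Finite] {G : Finset α}

/-- The high-level income from the start level `s`. -/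
noncomputable def highIncomeFrom (N s : ℕ) : ℚ :=
  ∑ i ∈ Finset.range (N + 1), if s ≤ i then
    (if N ≤ i + 3 then ((N.choose i : ℕ) : ℚ) * 3 / (((i + 5).choose 4 : ℕ) : ℚ)
      else 11 / 18 * max 0 (((N.choose i : ℕ) : ℚ) - 5 * (((N - 2).choose i : ℕ) : ℚ)) * 3 /
        (((i + 5).choose 4 : ℕ) : ℚ))
  else 0

omit [DecidableEq α] in
/-- **The abstract regrouping from the start level `s`.** -/
theorem highIncomeFrom_le_sum_filter (W : Finset α) (P : Finset α → Prop) [DecidablePred P] (s : ℕ)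
    (hcount : ∀ i, s ≤ i → ¬ W.card ≤ i + 3 →
      ((W.card.choose i : ℕ) : ℚ) - 5 * (((W.card - 2).choose i : ℕ) : ℚ) ≤
        (((W.powersetCard i).filter P).card : ℚ)) :
    highIncomeFrom W.card s ≤
      ∑ Y ∈ W.powerset.filter (fun Y => s ≤ Y.card ∧ (W.card ≤ Y.card + 3 ∨ P Y)),
        (if W.card ≤ Y.card + 3 then (1 : ℚ) else 11 / 18) * 3 / (((Y.card + 5).choose 4 : ℕ) : ℚ) := by
  set fam : Finset (Finset α) := W.powerset.filter (fun Y => s ≤ Y.card ∧ (W.card ≤ Y.card + 3 ∨ P Y))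
    with hfam
  have hmaps : ∀ Y ∈ fam, Y.card ∈ Finset.range (W.card + 1) := fun Y hY =>
    Finset.mem_range.2 (Nat.lt_succ_of_le (Finset.card_le_card
      (Finset.mem_powerset.1 (Finset.mem_filter.1 hY).1)))
  have hfiber := Finset.sum_fiberwise_of_maps_to hmaps
    (fun Y => (if W.card ≤ Y.card + 3 then (1 : ℚ) else 11 / 18) * 3 / (((Y.card + 5).choose 4 : ℕ) : ℚ))
  rw [← hfiber]
  unfold highIncomeFrom
  apply Finset.sum_le_sum
  intro i _
  have hfib : ∑ Y ∈ fam.filter (fun Y => Y.card = i),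
      (if W.card ≤ Y.card + 3 then (1 : ℚ) else 11 / 18) * 3 / (((Y.card + 5).choose 4 : ℕ) : ℚ) =
      ((fam.filter (fun Y => Y.card = i)).card : ℚ) *
        ((if W.card ≤ i + 3 then (1 : ℚ) else 11 / 18) * 3 / (((i + 5).choose 4 : ℕ) : ℚ)) := by
    rw [Finset.sum_congr rfl (fun Y hY => by rw [(Finset.mem_filter.1 hY).2])]
    rw [Finset.sum_const, nsmul_eq_mul]
  rw [hfib]
  split_ifs with hsi htop
  · have hsub : W.powersetCard i ⊆ fam.filter (fun Y => Y.card = i) := by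
      intro Y hY
      rw [Finset.mem_powersetCard] at hY
      rw [Finset.mem_filter, hfam, Finset.mem_filter, Finset.mem_powerset]
      exact ⟨⟨hY.1, by omega, Or.inl (by omega)⟩, hY.2⟩
    have hcard : ((W.card.choose i : ℕ) : ℚ) ≤ ((fam.filter (fun Y => Y.card = i)).card : ℚ) := by
      rw [← Finset.card_powersetCard]
      exact_mod_cast Finset.card_le_card hsub
    have hC : (0 : ℚ) ≤ 3 / (((i + 5).choose 4 : ℕ) : ℚ) := by positivity
    calc ((W.card.choose i : ℕ) : ℚ) * 3 / (((i + 5).choose 4 : ℕ) : ℚ)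
        = ((W.card.choose i : ℕ) : ℚ) * (3 / (((i + 5).choose 4 : ℕ) : ℚ)) := by ring
      _ ≤ ((fam.filter (fun Y => Y.card = i)).card : ℚ) * (3 / (((i + 5).choose 4 : ℕ) : ℚ)) :=
          mul_le_mul_of_nonneg_right hcard hC
      _ = ((fam.filter (fun Y => Y.card = i)).card : ℚ) * (1 * 3 / (((i + 5).choose 4 : ℕ) : ℚ)) := by ring
  · have hsub : (W.powersetCard i).filter P ⊆ fam.filter (fun Y => Y.card = i) := by
      intro Y hY
      rw [Finset.mem_filter, Finset.mem_powersetCard] at hY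
      obtain ⟨⟨hYW, hYi⟩, hP⟩ := hY
      rw [Finset.mem_filter, hfam, Finset.mem_filter, Finset.mem_powerset]
      exact ⟨⟨hYW, by omega, Or.inr hP⟩, hYi⟩
    have hcard : (((W.powersetCard i).filter P).card : ℚ) ≤ ((fam.filter (fun Y => Y.card = i)).card : ℚ) := by
      exact_mod_cast Finset.card_le_card hsub
    have hC : (0 : ℚ) ≤ 11 / 18 * 3 / (((i + 5).choose 4 : ℕ) : ℚ) := by positivity
    have hmax : max 0 (((W.card.choose i : ℕ) : ℚ) - 5 * (((W.card - 2).choose i : ℕ) : ℚ)) ≤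
        ((fam.filter (fun Y => Y.card = i)).card : ℚ) :=
      max_le (by positivity) (le_trans (hcount i hsi htop) hcard)
    calc 11 / 18 * max 0 (((W.card.choose i : ℕ) : ℚ) - 5 * (((W.card - 2).choose i : ℕ) : ℚ)) * 3 /
          (((i + 5).choose 4 : ℕ) : ℚ)
        = max 0 (((W.card.choose i : ℕ) : ℚ) - 5 * (((W.card - 2).choose i : ℕ) : ℚ)) *
            (11 / 18 * 3 / (((i + 5).choose 4 : ℕ) : ℚ)) := by ring
      _ ≤ ((fam.filter (fun Y => Y.card = i)).card : ℚ) * (11 / 18 * 3 / (((i + 5).choose 4 : ℕ) : ℚ)) :=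
          mul_le_mul_of_nonneg_right hmax hC
  all_goals positivity

/-- **The top-or-hitting targets from the start level `s`** (every one of them unloaded by hypothesis) are targets of
income at least `highIncomeFrom N s`. -/
theorem high_from_targets_subset_and_income (hG : G ∈ flatsQ M (5 + 1)) (hd : (gr M \ G).card = 2)
    (hk : kColoops M G = 1) (hnf : fatClosures M 5 G 2 = ∅) {B : Finset α}
    (hB : B ∈ thinMembers M 5 G) (hnP : ¬ bigP M G B) {z : α} (hz : z ∈ G \ clF M B)
    (hl0 : loss M 5 G B z ≠ 0) {s : ℕ} (hs1 : 1 ≤ s)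
    (hdl : ∀ Y ⊆ G \ insert z B, s ≤ Y.card → dload M 5 G (bigP M G) (dshGT2 M 5 G) (insert z B ∪ Y) = 0) :
    (((G \ insert z B).powerset.filter (fun Y => s ≤ Y.card ∧ ((G \ insert z B).card ≤ Y.card + 3 ∨
        ∀ w ∈ (insert z B \ coloops M G).filter (fun w => faceOk M G (insert z B) w),
          ¬ Y ⊆ clF M ((insert z B).erase w)))).image (fun Y => insert z B ∪ Y)) ⊆ tgtSets M 5 G B z ∧
      highIncomeFrom (G \ insert z B).card s ≤
        ∑ T ∈ ((G \ insert z B).powerset.filter (fun Y => s ≤ Y.card ∧ ((G \ insert z B).card ≤ Y.card + 3 ∨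
          ∀ w ∈ (insert z B \ coloops M G).filter (fun w => faceOk M G (insert z B) w),
            ¬ Y ⊆ clF M ((insert z B).erase w)))).image (fun Y => insert z B ∪ Y),
          vCap M G T / faceSum M G T := by
  set fam : Finset (Finset α) := (G \ insert z B).powerset.filter (fun Y => s ≤ Y.card ∧
    ((G \ insert z B).card ≤ Y.card + 3 ∨
      ∀ w ∈ (insert z B \ coloops M G).filter (fun w => faceOk M G (insert z B) w),
        ¬ Y ⊆ clF M ((insert z B).erase w))) with hfam
  set 𝒯 : Finset (Finset α) := fam.image (fun Y => insert z B ∪ Y) with h𝒯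
  have hmem : ∀ Y ∈ fam, Y ⊆ G \ insert z B ∧ s ≤ Y.card ∧ ((G \ insert z B).card ≤ Y.card + 3 ∨
      ∀ w ∈ (insert z B \ coloops M G).filter (fun w => faceOk M G (insert z B) w),
        ¬ Y ⊆ clF M ((insert z B).erase w)) := by
    intro Y hY
    rw [hfam, Finset.mem_filter, Finset.mem_powerset] at hY
    exact ⟨hY.1, hY.2.1, hY.2.2⟩
  have h𝒯sub : 𝒯 ⊆ tgtSets M 5 G B z := by
    intro T hT
    rw [h𝒯, Finset.mem_image] at hT
    obtain ⟨Y, hY, rfl⟩ := hT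
    obtain ⟨hYW, hYc, -⟩ := hmem Y hY
    rw [tgtSets_eq_image hG (mem_thinMembers.1 hB).1 hz, Finset.mem_image]
    refine ⟨Y, Finset.mem_filter.2 ⟨Finset.mem_powerset.2 hYW, ?_⟩, rfl⟩
    rw [← Finset.card_pos]
    omega
  have hinj : Set.InjOn (fun Y => insert z B ∪ Y) (fam : Set (Finset α)) := by
    intro Y₁ hY₁ Y₂ hY₂ heq
    rw [Finset.mem_coe] at hY₁ hY₂
    have key : ∀ Y ∈ fam, (insert z B ∪ Y) ∩ (G \ insert z B) = Y := by
      intro Y hY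
      ext x
      rw [Finset.mem_inter, Finset.mem_union]
      constructor
      · rintro ⟨hx | hx, hxW⟩
        · exact absurd hx (Finset.mem_sdiff.1 hxW).2
        · exact hx
      · intro hx
        exact ⟨Or.inr hx, (hmem Y hY).1 hx⟩
    have h1 := key Y₁ hY₁
    have h2 := key Y₂ hY₂
    simp only at heq
    rw [← h1, ← h2, heq]
  have hterm : ∀ Y ∈ fam, (if (G \ insert z B).card ≤ Y.card + 3 then (1 : ℚ) else 11 / 18) * 3 /
      (((Y.card + 5).choose 4 : ℕ) : ℚ) ≤ vCap M G (insert z B ∪ Y) / faceSum M G (insert z B ∪ Y) := by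
    intro Y hY
    obtain ⟨hYW, hYc, hYtop⟩ := hmem Y hY
    have hne : Y.Nonempty := by
      rw [← Finset.card_pos]
      omega
    exact free_term hG hd hk hnf hB hnP hz hl0 hYW hne (hdl Y hYW hYc) hYtop
  have hsum𝒯 : ∑ Y ∈ fam, (if (G \ insert z B).card ≤ Y.card + 3 then (1 : ℚ) else 11 / 18) * 3 /
      (((Y.card + 5).choose 4 : ℕ) : ℚ) ≤ ∑ T ∈ 𝒯, vCap M G T / faceSum M G T := by
    rw [h𝒯, Finset.sum_image hinj]
    exact Finset.sum_le_sum hterm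
  refine ⟨h𝒯sub, le_trans ?_ hsum𝒯⟩
  exact highIncomeFrom_le_sum_filter (G \ insert z B) _ s
    (fun i _ _ => card_filter_hitting_ge hG hd hk hnf hB hnP hz i)

/-- **THE HIGH-LEVEL THEOREM FROM THE LINES THROUGH THE BASIS**: with `L₂ / L₁ / L₀` bounding the points of `W` on the lines
with two / one / no basis point and `s = max (L₂ + 3) (max (L₁ + 2) (L₀ + 1))`, `1 ≤ highIncomeFrom |W| s` ⇒ fair. -/
theorem basis_pair_fair_of_high_levels_from (hG : G ∈ flatsQ M (5 + 1)) (hd : (gr M \ G).card = 2)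
    (hk : kColoops M G = 1) (hs : ∀ e ∈ gr M, ∀ f ∈ gr M, e ≠ f → rkN M {e, f} = 2)
    (hl : ∀ e ∈ gr M, M.Indep {e}) (hnf : fatClosures M 5 G 2 = ∅) {B : Finset α}
    (hB : B ∈ thinMembers M 5 G) (hnP : ¬ bigP M G B) {z : α} (hz : z ∈ G \ clF M B)
    (hl0 : loss M 5 G B z ≠ 0) {L₂ L₁ L₀ : ℕ}
    (h2 : ∀ a ∈ insert z B \ coloops M G, ∀ b ∈ insert z B \ coloops M G, a ≠ b →
      ((G \ insert z B) ∩ clF M {a, b}).card ≤ L₂)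
    (h1 : ∀ a ∈ insert z B \ coloops M G, ∀ y ∈ G \ insert z B, ((G \ insert z B) ∩ clF M {a, y}).card ≤ L₁)
    (h0 : ∀ x ∈ G \ insert z B, ∀ y ∈ G \ insert z B, x ≠ y → ((G \ insert z B) ∩ clF M {x, y}).card ≤ L₀)
    (hsum : 1 ≤ highIncomeFrom (G \ insert z B).card (max (L₂ + 3) (max (L₁ + 2) (L₀ + 1)))) :
    loss M 5 G B z ≤ rhoL M 5 G B z * lossIncomeH M 5 G (bigP M G) (dshGT2 M 5 G) B z := by
  have hfat : (fatClosures M 5 G 2).card ≤ 1 := by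
    rw [hnf, Finset.card_empty]
    exact zero_le_one
  obtain ⟨hsub, hinc⟩ := high_from_targets_subset_and_income hG hd hk hnf hB hnP hz hl0
    (s := max (L₂ + 3) (max (L₁ + 2) (L₀ + 1))) (by omega)
    (fun Y hY hYs => dload_eq_zero_of_level_of_three_lines_le hG hd hk hs hl hfat hB hnP hz h2 h1 h0 hY
      (by omega) (by omega) (by omega))
  exact basis_pair_fair_of_vCap_face_sum_subfamily hG hd hk hs hl hfat hB hnP hz hl0 hsub (hsum.trans hinc)

end PercRepro.Shadow
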